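import Summits.AnomalousDissipation.AnomalousDissipation.Theorems.TwoAndHalfDTwohalfdThesisStubShellNoGo
import Literature.Analysis.FluidPDE.TorusClassicalLerayHopfProofs

/-!
# H3 `stub_unforcedNoGo` — no unforced planar flow carries a W-witness (line `Sketch`, crux stmt-AnomalousDissipation-0206)

Registered tool stub of the line `Sketch` (duhamel-release) for the crux
`Summit.AnomalousDissipation.AnomalousDissipation.Theses.TwoAndHalfD.TwohalfdThesis`
(stmt-AnomalousDissipation-0206): the body of the line's open kernel W (`stub_releasedMixingWitness`) —
a steadily forced classical planar Navier–Stokes family `v_j` (`ν_j → 0`), classical releases `φ j s` of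
one smooth zero-mean pattern `h` with a `j`-uniform integrable `L²`-envelope `Λ` after the spin-up time
`s₀` and a Green–Kubo floor `ε > 0` — is CONTRADICTORY when the force vanishes, `g = 0`: a W-witness
must be driven.

* `unforced_intervalIntegral_gradNormSq_le` — the unforced classical energy equality
  (`IsClassicalNSSolutionOn.energy_eq` with force `0`, power term `0`): `∫₀ᵀ ‖∇v‖₂² ≤ ½‖v(0)‖²/ν`
  for every `T ≥ 0`.
* `unforced_exists_window_integral_le` — PIGEONHOLE over the adjacent windows
  `[s₀ + kτ₀, s₀ + (k+1)τ₀]`: a nonnegative locally integrable `G` with `∫₀ᵀ G ≤ B` for all `T ≥ 0`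
  has, for every `η > 0`, a late window `[s, s + τ₀]`, `s ≥ s₀`, with `∫ₛ^{s+τ₀} G ≤ η`.
* `unforced_setIntegral_sqrt_le_one` — JENSEN on one window (`timeMean_sqrt_le_sqrt_timeMean`):
  `∫ₛ^{s+τ₀} G ≤ 1/τ₀` gives `∫_{(0,τ₀)} √(G(s+τ)) dτ ≤ 1`.
* `unforced_exists_windowStrain_le_one` — hence an unforced classical planar flow on `[0, ∞)` has a
  late window with window strain `∫⁻_{(0,τ₀)} (‖∇v(s+τ)‖₂²)^{1/2} dτ ≤ ofReal 1`
  (`eGradNormSq = ofReal gradNormSq` on the smooth slices).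
* `stub_unforcedNoGo` — the registered statement: `h ≠ 0` by the Green–Kubo floor; a lossy lag `τ₀`
  (`Λ(τ₀) ≤ 1/2`, loss `δ = 3/4`, `exists_pos_lag_le_half`); the strain gate in W's format
  (`releasedFamily_logStrain`): `(3/4)‖h‖² log(1/ν_j) ≤ C(S+1)` on every late window with strain budget
  `S`; one index `j` with `ν_j ≤ κ₀` and `(3/4)‖h‖² log(1/ν_j) > 2C + 1`; its quiet late window
  (`S = 1`) is the contradiction.
Supports stmt-AnomalousDissipation-0206. [folklore: Crippa–De Lellis 2008; Seis 2022; Doering–Foias 2002 §2]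
-/

noncomputable section

-- the summit path `AnomalousDissipation/AnomalousDissipation` duplicates a namespace component
set_option linter.dupNamespace false

namespace Summit.AnomalousDissipation.AnomalousDissipation.Theorems.TwohalfdThesis

open MeasureTheory Set Filter Topology
open scoped ENNReal NNReal InnerProductSpace
open Literature.Analysis.FunctionSpaces Literature.Analysis.FluidPDE

/-- Local notation: the flat two-torus. -/
local notation "𝕋²" => UnitAddTorus (Fin 2)
/-- Local notation: planar velocity values. -/
local notation "E²" => EuclideanSpace ℝ (Fin 2)

/-! ## Real-variable bookkeeping: pigeonhole over adjacent windows, Jensen on one window -/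

/-- **Pigeonhole over adjacent windows.** If `G ≥ 0` is interval integrable on every `[a, b] ⊆ [0, ∞)`
and `∫₀ᵀ G ≤ B` for every `T ≥ 0`, then for `s₀ ≥ 0`, `τ₀ > 0` and `η > 0` some late window
`[s, s + τ₀]`, `s ≥ s₀`, has `∫ₛ^{s+τ₀} G ≤ η`: with `K > B/η` windows `[s₀ + kτ₀, s₀ + (k+1)τ₀]`,
`k < K`, the window integrals sum to `∫_{s₀}^{s₀+Kτ₀} G ≤ ∫₀^{s₀+Kτ₀} G ≤ B < Kη`
(`intervalIntegral.sum_integral_adjacent_intervals`), so one of them is `≤ η`. [folklore] -/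
theorem unforced_exists_window_integral_le {G : ℝ → ℝ} {s₀ τ₀ B η : ℝ} (hs₀ : 0 ≤ s₀)
    (hτ₀ : 0 < τ₀) (hη : 0 < η) (hG0 : ∀ σ, 0 ≤ G σ)
    (hGi : ∀ a b, 0 ≤ a → a ≤ b → IntervalIntegrable G volume a b)
    (hB : ∀ T, 0 ≤ T → ∫ τ in (0 : ℝ)..T, G τ ≤ B) :
    ∃ s, s₀ ≤ s ∧ ∫ τ in s..s + τ₀, G τ ≤ η := by
  have hB0 : 0 ≤ B := by simpa using hB 0 le_rfl
  obtain ⟨K, hK⟩ := exists_nat_gt (B / η)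
  have hKpos : 0 < K := by
    have : (0 : ℝ) < K := (div_nonneg hB0 hη.le).trans_lt hK
    exact_mod_cast this
  -- the window endpoints `s₀ + k τ₀`
  have ha0 : ∀ k : ℕ, s₀ ≤ s₀ + (k : ℝ) * τ₀ := fun k => le_add_of_nonneg_right (by positivity)
  have hstep : ∀ k : ℕ, s₀ + ((k + 1 : ℕ) : ℝ) * τ₀ = s₀ + (k : ℝ) * τ₀ + τ₀ := fun k => by
    push_cast; ring
  have hmono : ∀ k : ℕ, s₀ + (k : ℝ) * τ₀ ≤ s₀ + ((k + 1 : ℕ) : ℝ) * τ₀ := fun k => by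
    rw [hstep]; linarith
  have hsum : ∑ k ∈ Finset.range K, ∫ τ in (s₀ + (k : ℝ) * τ₀)..(s₀ + ((k + 1 : ℕ) : ℝ) * τ₀), G τ =
      ∫ τ in (s₀ + ((0 : ℕ) : ℝ) * τ₀)..(s₀ + (K : ℝ) * τ₀), G τ :=
    intervalIntegral.sum_integral_adjacent_intervals (a := fun k : ℕ => s₀ + (k : ℝ) * τ₀)
      fun k _ => hGi _ _ (hs₀.trans (ha0 k)) (hmono k)
  have htot : ∫ τ in (s₀ + ((0 : ℕ) : ℝ) * τ₀)..(s₀ + (K : ℝ) * τ₀), G τ ≤ B := by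
    have e0 : s₀ + ((0 : ℕ) : ℝ) * τ₀ = s₀ := by simp
    rw [e0]
    have hadd := intervalIntegral.integral_add_adjacent_intervals (hGi 0 s₀ le_rfl hs₀)
      (hGi s₀ (s₀ + (K : ℝ) * τ₀) hs₀ (ha0 K))
    have hnn : 0 ≤ ∫ τ in (0 : ℝ)..s₀, G τ := intervalIntegral.integral_nonneg hs₀ fun τ _ => hG0 τ
    linarith [hB (s₀ + (K : ℝ) * τ₀) (hs₀.trans (ha0 K))]
  have hle : ∑ k ∈ Finset.range K, ∫ τ in (s₀ + (k : ℝ) * τ₀)..(s₀ + ((k + 1 : ℕ) : ℝ) * τ₀), G τ ≤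
      ∑ _k ∈ Finset.range K, η := by
    rw [hsum, Finset.sum_const, Finset.card_range, nsmul_eq_mul]
    refine htot.trans ?_
    rw [div_lt_iff₀ hη] at hK
    exact hK.le
  obtain ⟨k, -, hk⟩ : ∃ k ∈ Finset.range K,
      ∫ τ in (s₀ + (k : ℝ) * τ₀)..(s₀ + ((k + 1 : ℕ) : ℝ) * τ₀), G τ ≤ η :=
    Finset.exists_le_of_sum_le (Finset.nonempty_range_iff.2 hKpos.ne') hle
  refine ⟨s₀ + (k : ℝ) * τ₀, ha0 k, ?_⟩
  rwa [hstep] at hk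

/-- **Jensen on one window.** If `G ≥ 0`, `τ ↦ G(s + τ)` is continuous on `[0, τ₀]`, `τ₀ > 0`, and
`∫ₛ^{s+τ₀} G ≤ 1/τ₀`, then `∫_{(0,τ₀)} √(G(s + τ)) dτ ≤ 1`: the running-mean Jensen inequality
`⟨√E⟩_{τ₀} ≤ √⟨E⟩_{τ₀}` (`timeMean_sqrt_le_sqrt_timeMean`) for `E(τ) = G(s + τ)`, whose mean is
`≤ 1/τ₀²`. [folklore] -/
theorem unforced_setIntegral_sqrt_le_one {G : ℝ → ℝ} {s τ₀ : ℝ} (hτ₀ : 0 < τ₀) (hG0 : ∀ σ, 0 ≤ G σ)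
    (hGc : ContinuousOn (fun τ => G (s + τ)) (Icc 0 τ₀))
    (hI : ∫ τ in s..s + τ₀, G τ ≤ 1 / τ₀) :
    ∫ τ in Ioo 0 τ₀, Real.sqrt (G (s + τ)) ≤ 1 := by
  have hEi : IntegrableOn (fun τ => G (s + τ)) (Ioc 0 τ₀) :=
    (hGc.integrableOn_compact isCompact_Icc).mono_set Ioc_subset_Icc_self
  have hJ : timeMean (fun t => Real.sqrt (G (s + t))) τ₀ ≤
      Real.sqrt (timeMean (fun t => G (s + t)) τ₀) :=
    timeMean_sqrt_le_sqrt_timeMean (E := fun t => G (s + t)) hτ₀ (fun t => hG0 (s + t)) hEi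
  have hshift : ∫ τ in (0 : ℝ)..τ₀, G (s + τ) = ∫ τ in s..s + τ₀, G τ := by
    have e := intervalIntegral.integral_comp_add_left G (a := 0) (b := τ₀) s
    simpa only [add_zero] using e
  have hmean : timeMean (fun t => G (s + t)) τ₀ ≤ τ₀⁻¹ * τ₀⁻¹ := by
    unfold timeMean
    rw [hshift]
    exact mul_le_mul_of_nonneg_left (by rwa [one_div] at hI) (inv_nonneg.2 hτ₀.le)
  have hsq : Real.sqrt (timeMean (fun t => G (s + t)) τ₀) ≤ τ₀⁻¹ :=
    (Real.sqrt_le_sqrt hmean).trans_eq (Real.sqrt_mul_self (inv_nonneg.2 hτ₀.le))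
  have hIoo : ∫ τ in Ioo 0 τ₀, Real.sqrt (G (s + τ)) =
      τ₀ * timeMean (fun t => Real.sqrt (G (s + t))) τ₀ := by
    rw [timeMean, mul_inv_cancel_left₀ hτ₀.ne', intervalIntegral.integral_of_le hτ₀.le,
      integral_Ioc_eq_integral_Ioo]
  rw [hIoo]
  calc τ₀ * timeMean (fun t => Real.sqrt (G (s + t))) τ₀ ≤ τ₀ * τ₀⁻¹ :=
        mul_le_mul_of_nonneg_left (hJ.trans hsq) hτ₀.le
    _ = 1 := mul_inv_cancel₀ hτ₀.ne'

/-! ## Unforced classical planar flows have quiet late windows -/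

/-- **The unforced energy equality as an enstrophy budget.** For a classical solution of the planar
Navier–Stokes system on `[0, ∞)` with force `g = 0` and `ν > 0`: `∫₀ᵀ ‖∇v‖₂² ≤ ½‖v(0)‖²/ν` for every
`T ≥ 0` (`IsClassicalNSSolutionOn.energy_eq`: the injected power vanishes and `½‖v(T)‖² ≥ 0`). [folklore] -/
theorem unforced_intervalIntegral_gradNormSq_le {ν' : ℝ} {g' : 𝕋² → E²} {v' : ℝ → 𝕋² → E²}
    {p' : ℝ → 𝕋² → ℝ} (hν' : 0 < ν')
    (hNS : Torus.IsClassicalNSSolutionOn (Ici 0) ν' (fun _ => g') v' p') (hg0 : g' = 0) {T : ℝ}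
    (hT : 0 ≤ T) :
    ∫ τ in (0 : ℝ)..T, Torus.gradNormSq (v' τ) ≤ Torus.kineticEnergy (v' 0) / ν' := by
  subst hg0
  have he := hNS.energy_eq (convex_Ici 0) hT Icc_subset_Ici_self
  simp only [Pi.zero_apply, inner_zero_left, integral_zero, intervalIntegral.integral_zero,
    add_zero] at he
  rw [le_div_iff₀ hν', mul_comm]
  linarith [Torus.kineticEnergy_nonneg (v' T)]

/-- **An unforced classical planar flow has a late window of unit strain.** For a classical solution of
the planar Navier–Stokes system on `[0, ∞)` with force `g = 0` and `ν > 0`, and every `s₀ ≥ 0`,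
`τ₀ > 0`, some `s ≥ s₀` has window strain `∫⁻_{(0,τ₀)} (‖∇v(s + τ)‖₂²)^{1/2} dτ ≤ ofReal 1`: the
enstrophy budget `∫₀ᵀ‖∇v‖₂² ≤ ½‖v(0)‖²/ν` and pigeonhole give a late window with `∫ₛ^{s+τ₀}‖∇v‖₂² ≤ 1/τ₀`;
on the smooth slices `eGradNormSq = ofReal gradNormSq` (`Torus.eGradNormSq_eq_ofReal_gradNormSq`), the
integrand is continuous, and Jensen bounds `∫_{(0,τ₀)} ‖∇v(s+τ)‖₂ dτ ≤ √τ₀ · √(1/τ₀) = 1`. [folklore] -/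
theorem unforced_exists_windowStrain_le_one {ν' : ℝ} {g' : 𝕋² → E²} {v' : ℝ → 𝕋² → E²}
    {p' : ℝ → 𝕋² → ℝ} (hν' : 0 < ν')
    (hNS : Torus.IsClassicalNSSolutionOn (Ici 0) ν' (fun _ => g') v' p') (hg0 : g' = 0) {s₀ τ₀ : ℝ}
    (hs₀ : 0 ≤ s₀) (hτ₀ : 0 < τ₀) :
    ∃ s, s₀ ≤ s ∧
      ∫⁻ τ in Ioo 0 τ₀, Torus.eGradNormSq (v' (s + τ)) ^ (1 / 2 : ℝ) ≤ ENNReal.ofReal 1 := by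
  have hu := hNS.smooth_velocity
  have hG0 : ∀ σ, 0 ≤ Torus.gradNormSq (v' σ) := fun σ => Torus.gradNormSq_nonneg _
  have hGc : ContinuousOn (fun σ => Torus.gradNormSq (v' σ)) (Ici 0) :=
    hu.continuousOn_gradNormSq (convex_Ici 0) (uniqueDiffOn_Ici 0)
  have hGi : ∀ a b, 0 ≤ a → a ≤ b →
      IntervalIntegrable (fun σ => Torus.gradNormSq (v' σ)) volume a b := fun a b ha hab =>
    (hGc.mono (by rw [uIcc_of_le hab]; exact (Icc_subset_Ici_iff hab).2 ha)).intervalIntegrable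
  -- pigeonhole: a late window with enstrophy budget `≤ 1/τ₀`
  obtain ⟨s, hs, hI⟩ := unforced_exists_window_integral_le (G := fun σ => Torus.gradNormSq (v' σ))
    hs₀ hτ₀ (one_div_pos.2 hτ₀) hG0 hGi
    (fun T hT => unforced_intervalIntegral_gradNormSq_le hν' hNS hg0 hT)
  refine ⟨s, hs, ?_⟩
  have hs0 : 0 ≤ s := hs₀.trans hs
  -- the integrand on the smooth slices `v' (s + τ)`, `τ > 0`
  have hcongr : ∫⁻ τ in Ioo 0 τ₀, Torus.eGradNormSq (v' (s + τ)) ^ (1 / 2 : ℝ) =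
      ∫⁻ τ in Ioo 0 τ₀, ENNReal.ofReal (Real.sqrt (Torus.gradNormSq (v' (s + τ)))) := by
    refine setLIntegral_congr_fun measurableSet_Ioo fun τ hτ => ?_
    have hmem : s + τ ∈ Ici (0 : ℝ) := mem_Ici.2 (by linarith [hτ.1])
    rw [Torus.eGradNormSq_eq_ofReal_gradNormSq (hu.isSmooth_slice hmem),
      ENNReal.ofReal_rpow_of_nonneg (hG0 (s + τ)) (by norm_num : (0 : ℝ) ≤ 1 / 2),
      Real.sqrt_eq_rpow]
  have hEc : ContinuousOn (fun τ => Torus.gradNormSq (v' (s + τ))) (Icc 0 τ₀) :=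
    hGc.comp (f := fun τ => s + τ) (continuous_const_add s).continuousOn
      fun τ hτ => mem_Ici.2 (by linarith [hτ.1])
  have hRi : IntegrableOn (fun τ => Real.sqrt (Torus.gradNormSq (v' (s + τ)))) (Ioo 0 τ₀) :=
    ((Real.continuous_sqrt.comp_continuousOn hEc).integrableOn_compact isCompact_Icc).mono_set
      Ioo_subset_Icc_self
  rw [hcongr, ← ofReal_integral_eq_lintegral_ofReal hRi
    (Eventually.of_forall fun τ => Real.sqrt_nonneg _)]
  exact ENNReal.ofReal_le_ofReal (unforced_setIntegral_sqrt_le_one hτ₀ hG0 hEc hI)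

/-! ## H3: the unforced no-go -/

/-- **H3 `stub_unforcedNoGo` (line `Sketch` = duhamel-release, crux `TwoAndHalfD.TwohalfdThesis`; registered
signature): NO UNFORCED PLANAR FLOW CARRIES A W-WITNESS.**  The body of the line's open witness
`stub_releasedMixingWitness` — classical planar Navier–Stokes family with steady force `g`, pointwise
energy `≤ E`, classical releases of `h` with a `j`-uniform integrable envelope after the spin-up time and a
Green–Kubo floor `ε > 0` — is contradictory when `g = 0`: the floor forces `h ≠ 0`; an integrable
envelope has a lossy lag `τ₀` (`Λ(τ₀) ≤ 1/2`, loss `δ = 3/4`); the strain gate in W's format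
(`releasedFamily_logStrain`) charges `(3/4)‖h‖² log(1/ν_j) ≤ C(S+1)` for every late window of strain
budget `S` once `ν_j ≤ κ₀`; but an UNFORCED flow dissipates at most its initial energy, so by pigeonhole
and Jensen it has a late window of unit strain (`unforced_exists_windowStrain_le_one`), while
`log(1/ν_j) → ∞`. [folklore] -/
theorem stub_unforcedNoGo :
    ∀ (g : (UnitAddTorus (Fin 2)) → (EuclideanSpace ℝ (Fin 2))) (h : (UnitAddTorus (Fin 2)) → ℝ),
      g = 0 → Torus.IsSmooth h → Torus.HasZeroMean h →
      ∀ (ν : ℕ → ℝ) (v : ℕ → ℝ → (UnitAddTorus (Fin 2)) → (EuclideanSpace ℝ (Fin 2))) (p : ℕ → ℝ → (UnitAddTorus (Fin 2)) → ℝ)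
        (φ : ℕ → ℝ → ℝ → (UnitAddTorus (Fin 2)) → ℝ) (Λ : ℝ → ℝ) (E s₀ M ε : ℝ),
        (∀ j, 0 < ν j) → Tendsto ν atTop (𝓝 0) →
        (∀ j, Torus.IsClassicalNSSolutionOn (Ici 0) (ν j) (fun _ => g) (v j) (p j)) →
        (∀ j t, 0 ≤ t → ∫ x, ‖v j t x‖ ^ 2 ≤ E) →
        (∀ j s, 0 ≤ s → Torus.IsClassicalScalarTransportOn (Ici s) (ν j) (v j) (φ j s) ∧ φ j s s = h) →
        0 ≤ s₀ → (∀ τ, 0 ≤ Λ τ) → IntegrableOn Λ (Ici 0) → (∫ τ in Ici 0, Λ τ) ≤ M →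
        (∀ j s t, s₀ ≤ s → s ≤ t → Torus.scalarL2Sq (φ j s t) ≤ Λ (t - s) ^ 2 * Torus.scalarL2Sq h) →
        0 < ε →
        (∀ j, ε ≤ liminf (timeMean fun t => ∫ s in (0 : ℝ)..t, ∫ x, h x * φ j s t x) atTop) →
        False := by
  intro g h hg0 hhs _hhz ν v p φ Λ E s₀ M ε hν hν0 hNS _hE hrel hs₀ hΛ0 hΛi _hΛM henv hε hGK
  -- `h ≠ 0` by the Green–Kubo floor
  have hh0 : 0 < Torus.scalarL2Sq h := by
    by_contra hcon
    have hzero : h = 0 := by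
      by_contra hne
      exact hcon (scalarL2Sq_pos_of_ne_zero hhs hne)
    have h1 := hGK 0
    have hconst : (timeMean fun t => ∫ s in (0 : ℝ)..t, ∫ x, h x * φ 0 s t x) = fun _ => 0 := by
      funext T
      simp [timeMean, hzero]
    rw [hconst, liminf_const] at h1
    exact absurd h1 (not_le.2 hε)
  -- a lossy lag: loss `δ = 3/4` by age `τ₀` from every late release
  obtain ⟨τ₀, hτ₀, hΛτ⟩ := exists_pos_lag_le_half hΛi
  have hloss : ∀ j s, s₀ ≤ s →
      Torus.scalarL2Sq (φ j s (s + τ₀)) ≤ (1 - 3 / 4) * Torus.scalarL2Sq h := by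
    intro j s hs
    have h1 := henv j s (s + τ₀) hs (by linarith)
    rw [add_sub_cancel_left] at h1
    have hΛsq : Λ τ₀ ^ 2 ≤ 1 / 4 := by nlinarith [hΛ0 τ₀]
    calc Torus.scalarL2Sq (φ j s (s + τ₀)) ≤ Λ τ₀ ^ 2 * Torus.scalarL2Sq h := h1
      _ ≤ (1 / 4) * Torus.scalarL2Sq h := mul_le_mul_of_nonneg_right hΛsq hh0.le
      _ = (1 - 3 / 4) * Torus.scalarL2Sq h := by norm_num
  -- the strain gate in W's format
  obtain ⟨κ₀, C, hκ₀, -, -, hmain⟩ := releasedFamily_logStrain hν hhs hτ₀ hrel hs₀ hloss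
  -- one low-viscosity index with `(3/4)‖h‖² log(1/ν_j) > 2C + 1`
  have hpos : 0 < 3 / 4 * Torus.scalarL2Sq h := by positivity
  have hev1 : ∀ᶠ j in atTop, ν j ≤ κ₀ := hν0.eventually_le_const hκ₀
  have hev2 : ∀ᶠ j in atTop,
      (C * (1 + 1) + 1) / (3 / 4 * Torus.scalarL2Sq h) ≤ Real.log (ν j)⁻¹ :=
    (tendsto_log_inv_atTop_of_tendsto_zero hν hν0).eventually_ge_atTop _
  obtain ⟨j, hj1, hj2⟩ := (hev1.and hev2).exists
  rw [div_le_iff₀ hpos] at hj2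
  -- its flow is unforced: a late window of unit strain
  obtain ⟨s, hs, hstrain⟩ := unforced_exists_windowStrain_le_one (hν j) (hNS j) hg0 hs₀ hτ₀
  have hm := hmain j hj1 s hs 1 zero_le_one hstrain
  have hcomm : Real.log (ν j)⁻¹ * (3 / 4 * Torus.scalarL2Sq h) =
      3 / 4 * Torus.scalarL2Sq h * Real.log (ν j)⁻¹ := mul_comm _ _
  rw [hcomm] at hj2
  linarith

end Summit.AnomalousDissipation.AnomalousDissipation.Theorems.TwohalfdThesis

end
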